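import Summits.QuantumFields.BalabanUV.Beta.FP.FineSplitJunctionWindows
import Literature.MathematicalPhysics.QuantumFieldTheory.Balaban1983to89.Beta.GradedBubbles

/-!
# `BalabanUV.Beta.FP.FineSplitJunctionTranspose` — road «FP» for binder row D1, row KER-γ «THE JUNCTION» ∕ (α2) sub-row **α2-c** «GHOST» (c): THE TRANSPOSE RULE —
# the (LEDGER) line of the TRANSPOSED near-table piece `Gᵀ c e s s′ := G e c s′ s` at the coarse entry `(b, a)` IS the line of `G` at `(a, b)`, for a block-periodic `G`
# and a block-covariant `K` (an IDENTITY of the junction's windowed sandwich under `u ↦ −u`; no summability, no estimate), so that every ASYMMETRIC word (the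
# (MIX-3) ghost word with `Ḣ` at `s`, the (MIX-4) word with the outer∕inner letters exchanged, leaf-01's non-symmetric gluon bi-tables) owes ONE ledger line, not two

HONEST DEPENDENCY (page 1, mandatory): continuum YM on T⁴ ⇐ BetaPertH ∧ nine spine estimates (0/9 proved); BetaPertH ⇐ (D1) ∧ (D4) ∧
CAP+tail; G-an2-4 gates asym, D1 and NE2/3/4.  HONEST FRAMING (cell contract, verbatim): «discharging `BetaPertH` makes Bałaban's UV
stability UNCONDITIONAL — a real constructive-QFT result; it is NOT the continuum limit and NOT the Clay problem.»  THIS MODULE is [folklore] reindexing of absolutely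
general (not necessarily convergent) lattice `tsum`s on `ℤ⁴ × ℤ⁴` by equivalences (swap, joint block translation) plus `FineSplitJunctionWindows.dressedEntryP_colH_anchor`
and `PerfectBubbleExpansion.colH_of_blockCov` BY NAME; it defines nothing, asserts nothing about Bałaban's constrained objects, cites nothing, mints no `Prop` fact,
0 sorry.  NOT (H2), NOT the (LEDGER)'s numbers, NOT hsplit, NOT (ASYMP), NOT D1; 0∕4 row-D1 binders; NOT BetaPertH, NOT continuum, NOT Clay.

ABSOLUTE RULE (cell charter, verbatim): «No internally-minted statement may enter as a cited fact. Every hypothesis is either kernel-proved in this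
package or a verbatim quotation of a PUBLISHED theorem with page reference. The manuscript(s) under audit are NOT citable for their own disputed
steps — they are the thing under adjudication; programme-internal (2001/route/tribunal) claims are never citable.»

CONTENT ([folklore]; `N`, `K : MKer 4 (Fib 3)`, `G : EKer₂ 4`; `hKcov : ∀ t, shiftK (−(N•t)) K = K`; `Gᵀ` is written `fun c e s s′ => G e c s′ s` — no def):
* §1 `isBlockPeriodic_transpose` (block periodicity passes to the transposed table); **`dressedSumP_transpose_anchor`** — for a block-periodic two-point table `P`:
  `dressedSumP (colH K N b 0 e) (Pᵀ) (colH K N a u₀ c) 0 = dressedSumP (colH K N a 0 c) P (colH K N b (−u₀) e) 0` (reindex `(u, x) ↦ (x − N•u₀, u − N•u₀)`);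
  **`dressedEntryP_transpose_anchor`** — `dressedEntryP (c a′ ↦ colH K N a′ 0 c) Gᵀ (N•(−u₀)) b a = dressedEntryP (c a′ ↦ colH K N a′ 0 c) G (N•(−(−u₀))) a b`.
* §2 **`ledger_transpose`** — `(∀ S′, Σ_{u∈S′}‖u‖∞²·|dressedEntryP (…) G (N•(−u)) a b| ≤ B) → ∀ S′, Σ_{u∈S′}‖u‖∞²·|dressedEntryP (…) Gᵀ (N•(−u)) b a| ≤ B` (the finite coarse
  set is reflected; `‖−u‖∞ = ‖u‖∞` is `GradedBubbles.supNorm_neg`); `bounded_transpose` (F∕F′'s `hGb` passes to `Gᵀ`).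
Provenance: D1 formalisation swarm LEAF PROVER 05, unit `b2b-balaban-beta-d1-formalise-leaf-05` gen 16, 2026-08-21, road FP row KER-γ (α2) sub-row α2-c (c) (lineage menu of
the g15 CLOSING ADDENDUM «transpose rule for the asymmetric words»); «not in print; our bookkeeping»; no existing file touched.
-/

noncomputable section

namespace Summit.QuantumFields.BalabanUV.Beta.FP.FineSplitJunctionTranspose

open Finset
open scoped BigOperators
open Literature.MathematicalPhysics.QuantumFieldTheory.Balaban1983to89
open Literature.MathematicalPhysics.QuantumFieldTheory.Balaban1983to89.Beta
open ExpKernelCalculus (Site MKer shiftK)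
open OneStepResolventKernel (Fib)
open OneStepKernelFamily (colH)
open DyadicShell (Pt supNorm)
open GradedBubbles (supNorm_neg)
open Summit.QuantumFields.BalabanUV.Beta.D1BFx.MomentTransferPeriodic (Ker₂ IsBlockPeriodic)
open Summit.QuantumFields.BalabanUV.Beta.D1BFx.MomentTransferPeriodicSum (dressedSumP)
open Summit.QuantumFields.BalabanUV.Beta.D1BFx.MomentTransferPeriodicEntry (EKer₂ dressedEntryP)
open Summit.QuantumFields.BalabanUV.Beta.FP.PerfectBubbleExpansion (colH_of_blockCov)
open Summit.QuantumFields.BalabanUV.Beta.FP.FineSplitJunctionWindows (dressedEntryP_colH_anchor)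

variable {N : ℕ} {K : MKer (3 + 1) (Fib 3)} {G : EKer₂ 4} {a b : Fin 4}

/-! ## §1 The transposed table: block periodicity and the anchor identity -/

/-- [folklore] Block periodicity passes to the transposed two-point table `Pᵀ s s′ := P s′ s`. -/
theorem isBlockPeriodic_transpose {P : Ker₂ 4} (hP : IsBlockPeriodic N P) : IsBlockPeriodic N (fun s s' => P s' s) :=
  fun z s s' => hP z s' s

/-- **THE ANCHOR IDENTITY FOR THE TRANSPOSED TABLE** [folklore]: for a block-periodic two-point table `P` and a block-covariant `K`,
`dressedSumP (colH K N b 0 e) Pᵀ (colH K N a u₀ c) 0 = dressedSumP (colH K N a 0 c) P (colH K N b (−u₀) e) 0` — the `tsum` over `ℤ⁴ × ℤ⁴` reindexed by the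
equivalence `(u, x) ↦ (x − N•u₀, u − N•u₀)` (swap, then the joint block translation that moves the running column's base point from `u₀` to `0` and the
reference column's from `0` to `−u₀`); `colH_of_blockCov` on both columns, block periodicity on `P`; NO summability needed. -/
theorem dressedSumP_transpose_anchor (hKcov : ∀ t : Fin (3 + 1) → ℤ, shiftK (-((N : ℤ) • t)) K = K)
    {P : Ker₂ 4} (hP : IsBlockPeriodic N P) (a c b e : Fin 4) (u₀ : Pt) :
    dressedSumP (colH K N b 0 e) (fun s s' => P s' s) (colH K N a u₀ c) 0 = dressedSumP (colH K N a 0 c) P (colH K N b (-u₀) e) 0 := by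
  unfold dressedSumP
  symm
  rw [← ((Equiv.prodComm Pt Pt).trans ((Equiv.subRight ((N : ℤ) • u₀)).prodCongr (Equiv.subRight ((N : ℤ) • u₀)))).tsum_eq]
  refine tsum_congr fun p => ?_
  show colH K N a 0 c (p.2 - (N : ℤ) • u₀) * P (0 + (p.2 - (N : ℤ) • u₀)) (p.1 - (N : ℤ) • u₀) * colH K N b (-u₀) e (p.1 - (N : ℤ) • u₀)
      = colH K N b 0 e p.1 * P p.2 (0 + p.1) * colH K N a u₀ c p.2
  have h1 : colH K N a u₀ c p.2 = colH K N a 0 c (p.2 - (N : ℤ) • u₀) := colH_of_blockCov hKcov a u₀ c p.2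
  have h2 : colH K N b (-u₀) e (p.1 - (N : ℤ) • u₀) = colH K N b 0 e p.1 := by
    rw [colH_of_blockCov hKcov b (-u₀) e (p.1 - (N : ℤ) • u₀), smul_neg, sub_neg_eq_add, sub_add_cancel]
  have h3 : P (p.2 - (N : ℤ) • u₀) (p.1 - (N : ℤ) • u₀) = P p.2 p.1 := by
    have h := hP (-u₀) p.2 p.1
    rwa [smul_neg, ← sub_eq_add_neg, ← sub_eq_add_neg] at h
  rw [zero_add, zero_add, h1, h2, h3]
  ring

/-- **THE WINDOWED SANDWICH OF THE TRANSPOSED PIECE** [folklore]: block-periodic `G` (every `(c, e)`), block-covariant `K` ⟹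
`dressedEntryP (c a′ ↦ colH K N a′ 0 c) Gᵀ (N•(−u₀)) b a = dressedEntryP (c a′ ↦ colH K N a′ 0 c) G (N•(−(−u₀))) a b` — the coarse entry `(b, a)` of the transposed
table at the coarse separation `u₀` is the entry `(a, b)` of the table at `−u₀` (`dressedEntryP_colH_anchor` twice + §1 + the exchange of the fibre sums). -/
theorem dressedEntryP_transpose_anchor (hKcov : ∀ t : Fin (3 + 1) → ℤ, shiftK (-((N : ℤ) • t)) K = K)
    (hGper : ∀ c e, IsBlockPeriodic N (G c e)) (a b : Fin 4) (u₀ : Pt) :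
    dressedEntryP (fun c a' => colH K N a' 0 c) (fun c e s s' => G e c s' s) ((N : ℤ) • (-u₀)) b a
      = dressedEntryP (fun c a' => colH K N a' 0 c) G ((N : ℤ) • (-(-u₀))) a b := by
  rw [dressedEntryP_colH_anchor hKcov (G := fun c e s s' => G e c s' s) (fun c e => isBlockPeriodic_transpose (hGper e c)) b a u₀,
    dressedEntryP_colH_anchor hKcov hGper a b (-u₀), Finset.sum_comm]
  exact Finset.sum_congr rfl fun c _ => Finset.sum_congr rfl fun e _ => dressedSumP_transpose_anchor hKcov (hGper c e) a c b e u₀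

/-! ## §2 The ledger line and the entry bound pass to the transposed piece -/

/-- [folklore] F∕F′'s entry bound `hGb` passes to the transposed table. -/
theorem bounded_transpose (hGb : ∀ c e, ∃ A, ∀ s s', |G c e s s'| ≤ A) (c e : Fin 4) :
    ∃ A, ∀ s s', |(fun c e s s' => G e c s' s) c e s s'| ≤ A := by
  obtain ⟨A, hA⟩ := hGb e c
  exact ⟨A, fun s s' => hA s' s⟩

/-- **THE TRANSPOSE RULE FOR THE (LEDGER)** [folklore]: block-periodic `G`, block-covariant `K`; if the piece `G` has the ledger line
`∀ S′, Σ_{u∈S′}‖u‖∞²·|dressedEntryP (c a′ ↦ colH K N a′ 0 c) G (N•(−u)) a b| ≤ B` at the coarse entry `(a, b)`, then the TRANSPOSED piece `Gᵀ c e s s′ := G e c s′ s` has the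
SAME line at `(b, a)`: `∀ S′, Σ_{u∈S′}‖u‖∞²·|dressedEntryP (c a′ ↦ colH K N a′ 0 c) Gᵀ (N•(−u)) b a| ≤ B` (apply the hypothesis to the reflected set `−S′`; `‖−u‖∞ = ‖u‖∞`). -/
theorem ledger_transpose (hKcov : ∀ t : Fin (3 + 1) → ℤ, shiftK (-((N : ℤ) • t)) K = K)
    (hGper : ∀ c e, IsBlockPeriodic N (G c e)) {B : ℝ}
    (hL : ∀ S' : Finset Pt, ∑ u ∈ S', (supNorm u : ℝ) ^ 2 * |dressedEntryP (fun c a' => colH K N a' 0 c) G ((N : ℤ) • (-u)) a b| ≤ B) :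
    ∀ S' : Finset Pt, ∑ u ∈ S', (supNorm u : ℝ) ^ 2 *
        |dressedEntryP (fun c a' => colH K N a' 0 c) (fun c e s s' => G e c s' s) ((N : ℤ) • (-u)) b a| ≤ B := by
  intro S'
  have h := hL (S'.map (Equiv.neg Pt).toEmbedding)
  rw [Finset.sum_map] at h
  refine le_trans (le_of_eq (Finset.sum_congr rfl fun u _ => ?_)) h
  show (supNorm u : ℝ) ^ 2 * |dressedEntryP (fun c a' => colH K N a' 0 c) (fun c e s s' => G e c s' s) ((N : ℤ) • (-u)) b a|
      = (supNorm (-u) : ℝ) ^ 2 * |dressedEntryP (fun c a' => colH K N a' 0 c) G ((N : ℤ) • (-(-u))) a b|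
  rw [dressedEntryP_transpose_anchor hKcov hGper a b u, supNorm_neg]

end Summit.QuantumFields.BalabanUV.Beta.FP.FineSplitJunctionTranspose

end
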